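import Literature.MathematicalPhysics.QuantumLattice.HubbardEnergyDensityVariationalPrinciple
import HarnessLib

/-!
# Canonical minimisers of the 2D Hubbard energy density are grand-canonical minimisers:
# the chemical potential

Topic `Literature/MathematicalPhysics/QuantumLattice`; namespace
`Literature.MathematicalPhysics.QuantumLattice` (the file path). Continuation of
`HubbardEnergyDensityVariationalPrinciple.lean` (`energyDensity2D t U ρ` is the least Hubbard
energy density `e(ω)` of a translation-invariant state `ω` on `ℤ²` of density `ρ ∈ (0,2)`).
Here: a translation-invariant state `ω` of density `ρ ∈ (0,2)` ATTAINING `energyDensity2D t U ρ`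
(a canonical minimiser — e.g. every torus limit of sector ground states) minimises
`e(ω') - μ ρ(ω')` over ALL translation-invariant states `ω'`, for a chemical potential `μ` (any
supporting slope of the convex `energyDensity2D t U` at `ρ`):
`exists_chemicalPotential_of_hubbardEnergyDensity_eq`. This is the `T = 0` equivalence of the
canonical and grand-canonical variational principles (Ruelle 1969 §3.4; Bratteli–Robinson II
§6.2.4), and puts the canonical minimisers in the scope of the Bratteli–Kishimoto–Robinson
theory of mean-energy minimisers for the interaction `Φ_{t,U} - μ n`.

Ingredients, all proved here from positivity of states: the degenerate Cauchy–Schwarz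
inequality `ω(X⋆X) = 0 ⇒ ω(X⋆Y) = 0`; `0 ≤ ω(P) ≤ 1` for projections, whence `0 ≤ ρ(ω) ≤ 2`;
and the energy density of the two extreme translation-invariant states: `e(ω) = 0` at density `0`
and `e(ω) = U` at density `2` (no hopping by Cauchy–Schwarz, no / full double occupancy).
No definition, no named fact, no sorry.
-/

noncomputable section

namespace Literature.MathematicalPhysics.QuantumLattice

open Matrix Finset HubbardWave0 _root_.Filter Literature.Probability.LatticeModels ThermodynamicLimit
open scoped _root_.Topology ComplexOrder

namespace InfVolFermionState

section Positivity

variable {d : ℕ} (ω : InfVolFermionState d)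

/-- **Cauchy–Schwarz, degenerate case**: if `ω(X⋆X) = 0` then `ω(X⋆Y) = 0` for every `Y`
(positivity of `ω((Y + μX)⋆(Y + μX))` for `μ = -s ω(X⋆Y)`, `s → ∞`). Bratteli–Robinson I
Lemma 2.3.10. [cite: BratteliRobinsonI1987, Lemma 2.3.10] -/
theorem expect_conjTranspose_mul_eq_zero (Λ : Finset (Site d)) {X : FermionOp Λ} (Y : FermionOp Λ)
    (hX : ω.expect Λ (Xᴴ * X) = 0) : ω.expect Λ (Xᴴ * Y) = 0 := by
  set z := ω.expect Λ (Xᴴ * Y) with hz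
  have hYX : ω.expect Λ (Yᴴ * X) = star z := by
    rw [hz, ← expect_conjTranspose, conjTranspose_mul, conjTranspose_conjTranspose]
  have key : ∀ s : ℝ, 0 ≤ (ω.expect Λ (Yᴴ * Y)).re - 2 * s * Complex.normSq z := by
    intro s
    have hexp : ∀ μ : ℂ, (Y + μ • X)ᴴ * (Y + μ • X) =
        Yᴴ * Y + μ • (Yᴴ * X) + star μ • (Xᴴ * Y) + (μ * star μ) • (Xᴴ * X) := by
      intro μ
      simp only [conjTranspose_add, conjTranspose_smul, add_mul, mul_add, Matrix.mul_smul, Matrix.smul_mul,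
        smul_smul]
      abel
    have h := ω.expect_nonneg Λ (Y + (-((s : ℂ) * z)) • X)
    rw [hexp, map_add, map_add, map_add, map_smul, map_smul, map_smul, hYX, hX, ← hz, smul_zero,
      add_zero] at h
    have hre := (Complex.nonneg_iff.1 h).1
    simp only [smul_eq_mul, Complex.add_re, Complex.mul_re, Complex.mul_im, Complex.neg_re, Complex.neg_im,
      Complex.star_def, Complex.conj_re, Complex.conj_im, Complex.ofReal_re, Complex.ofReal_im, star_neg,
      star_mul', Complex.conj_ofReal] at hre
    rw [Complex.normSq_apply]
    nlinarith [hre]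
  by_contra hz0
  have hpos : 0 < Complex.normSq z := Complex.normSq_pos.2 hz0
  have h := key (((ω.expect Λ (Yᴴ * Y)).re + 1) / (2 * Complex.normSq z))
  have h1 : 2 * (((ω.expect Λ (Yᴴ * Y)).re + 1) / (2 * Complex.normSq z)) * Complex.normSq z =
      (ω.expect Λ (Yᴴ * Y)).re + 1 := by
    field_simp
  linarith

/-- Right-handed form: `ω(Y⋆Y) = 0 ⇒ ω(X⋆Y) = 0`. [cite: BratteliRobinsonI1987, Lemma 2.3.10] -/
theorem expect_conjTranspose_mul_eq_zero' (Λ : Finset (Site d)) (X : FermionOp Λ) {Y : FermionOp Λ}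
    (hY : ω.expect Λ (Yᴴ * Y) = 0) : ω.expect Λ (Xᴴ * Y) = 0 := by
  have h := ω.expect_conjTranspose_mul_eq_zero Λ X hY
  have hc : (Yᴴ * X)ᴴ = Xᴴ * Y := by rw [conjTranspose_mul, conjTranspose_conjTranspose]
  rw [← hc, expect_conjTranspose, h, star_zero]

/-- **Projections have expectation in `[0,1]`, lower half**: `0 ≤ Re ω(P)` for a Hermitian
idempotent `P` (`P = P⋆P`). [cite: BratteliRobinsonI1987, §2.3.2] -/
theorem re_expect_nonneg_of_isHermitian_of_isIdempotentElem (Λ : Finset (Site d)) {P : FermionOp Λ}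
    (hP : P.IsHermitian) (hP2 : IsIdempotentElem P) : 0 ≤ (ω.expect Λ P).re := by
  have h := ω.expect_nonneg Λ P
  rw [hP.eq, hP2.eq] at h
  exact (Complex.nonneg_iff.1 h).1

/-- The expectation of a Hermitian idempotent is real. [cite: BratteliRobinsonI1987, §2.3.2] -/
theorem im_expect_eq_zero_of_isHermitian_of_isIdempotentElem (Λ : Finset (Site d)) {P : FermionOp Λ}
    (hP : P.IsHermitian) (hP2 : IsIdempotentElem P) : (ω.expect Λ P).im = 0 := by
  have h := ω.expect_nonneg Λ P
  rw [hP.eq, hP2.eq] at h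
  exact (Complex.nonneg_iff.1 h).2.symm

/-- **Upper half**: `Re ω(P) ≤ 1` for a Hermitian idempotent `P` (apply the lower half to
`1 - P`). [cite: BratteliRobinsonI1987, §2.3.2] -/
theorem re_expect_le_one_of_isHermitian_of_isIdempotentElem (Λ : Finset (Site d)) {P : FermionOp Λ}
    (hP : P.IsHermitian) (hP2 : IsIdempotentElem P) : (ω.expect Λ P).re ≤ 1 := by
  have h := ω.re_expect_nonneg_of_isHermitian_of_isIdempotentElem Λ (Matrix.isHermitian_one.sub hP) hP2.one_sub
  rw [map_sub, ω.expect_one, Complex.sub_re, Complex.one_re] at h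
  linarith

/-- The product of two commuting Hermitian idempotents is a Hermitian idempotent. [folklore] -/
theorem isHermitian_isIdempotentElem_mul_of_commute {Λ : Finset (Site d)} {P Q : FermionOp Λ}
    (hPQ : Commute P Q) (hP : P.IsHermitian) (hP2 : IsIdempotentElem P) (hQ : Q.IsHermitian)
    (hQ2 : IsIdempotentElem Q) : (P * Q).IsHermitian ∧ IsIdempotentElem (P * Q) := by
  refine ⟨?_, hP2.mul_of_commute hPQ hQ2⟩
  rw [Matrix.IsHermitian, conjTranspose_mul, hP.eq, hQ.eq, hPQ.eq]

/-- **Occupation numbers lie in `[0,1]`**: `0 ≤ Re ω(n_{xσ})`. [cite: ArakiMoriya2003, §4.1] -/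
theorem re_expect_nAt_nonneg (Λ : Finset (Site d)) {x : Site d} (hx : x ∈ Λ) (σ : Fin 2) :
    0 ≤ (ω.expect Λ (nAt x hx σ)).re := by
  rw [nAt, ← numberAt_orb]
  exact ω.re_expect_nonneg_of_isHermitian_of_isIdempotentElem Λ (numberAt_isHermitian _) (numberAt_idempotent _)

/-- `Re ω(n_{xσ}) ≤ 1`. [cite: ArakiMoriya2003, §4.1] -/
theorem re_expect_nAt_le_one (Λ : Finset (Site d)) {x : Site d} (hx : x ∈ Λ) (σ : Fin 2) :
    (ω.expect Λ (nAt x hx σ)).re ≤ 1 := by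
  rw [nAt, ← numberAt_orb]
  exact ω.re_expect_le_one_of_isHermitian_of_isIdempotentElem Λ (numberAt_isHermitian _) (numberAt_idempotent _)

/-- `ω(n_{xσ})` is real. [cite: ArakiMoriya2003, §4.1] -/
theorem im_expect_nAt (Λ : Finset (Site d)) {x : Site d} (hx : x ∈ Λ) (σ : Fin 2) :
    (ω.expect Λ (nAt x hx σ)).im = 0 := by
  rw [nAt, ← numberAt_orb]
  exact ω.im_expect_eq_zero_of_isHermitian_of_isIdempotentElem Λ (numberAt_isHermitian _) (numberAt_idempotent _)

/-- **The particle density is between `0` and `2`**, lower bound. [cite: ArakiMoriya2003, §4.1] -/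
theorem density_nonneg : 0 ≤ ω.density := by
  rw [density, densityAt, map_add, Complex.add_re]
  exact add_nonneg (ω.re_expect_nAt_nonneg _ _ _) (ω.re_expect_nAt_nonneg _ _ _)

/-- **The particle density is between `0` and `2`**, upper bound (two spin states per site).
[cite: ArakiMoriya2003, §4.1] -/
theorem density_le_two : ω.density ≤ 2 := by
  rw [density, densityAt, map_add, Complex.add_re]
  linarith [ω.re_expect_nAt_le_one {0} (mem_singleton_self 0) 0, ω.re_expect_nAt_le_one {0} (mem_singleton_self 0) 1]

end Positivity

/-! ### The two extreme translation-invariant densities -/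

section Extreme

variable {ω : InfVolFermionState 2}

/-- At density `0` every occupation number vanishes: `ω(n_{0σ}) = 0`. [cite: ArakiMoriya2003, §4.1] -/
theorem expect_nAt_eq_zero_of_density_eq_zero (hρ : ω.density = 0) :
    ∀ σ : Fin 2, ω.expect {0} (nAt 0 (mem_singleton_self 0) σ) = 0 := by
  have h0 := ω.re_expect_nAt_nonneg {0} (mem_singleton_self 0) 0
  have h1 := ω.re_expect_nAt_nonneg {0} (mem_singleton_self 0) 1
  rw [density, densityAt, map_add, Complex.add_re] at hρ
  refine Fin.forall_fin_two.2 ⟨Complex.ext ?_ ?_, Complex.ext ?_ ?_⟩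
  · rw [Complex.zero_re]; linarith
  · rw [im_expect_nAt, Complex.zero_im]
  · rw [Complex.zero_re]; linarith
  · rw [im_expect_nAt, Complex.zero_im]

/-- At density `2` every orbital is full: `ω(n_{0σ}) = 1`. [cite: ArakiMoriya2003, §4.1] -/
theorem expect_nAt_eq_one_of_density_eq_two (hρ : ω.density = 2) :
    ∀ σ : Fin 2, ω.expect {0} (nAt 0 (mem_singleton_self 0) σ) = 1 := by
  have h0 := ω.re_expect_nAt_le_one {0} (mem_singleton_self 0) 0
  have h1 := ω.re_expect_nAt_le_one {0} (mem_singleton_self 0) 1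
  rw [density, densityAt, map_add, Complex.add_re] at hρ
  refine Fin.forall_fin_two.2 ⟨Complex.ext ?_ ?_, Complex.ext ?_ ?_⟩
  · rw [Complex.one_re]; linarith
  · rw [im_expect_nAt, Complex.one_im]
  · rw [Complex.one_re]; linarith
  · rw [im_expect_nAt, Complex.one_im]

/-- `Re ω(n_{0↑} n_{0↓}) ≤ Re ω(n_{0↑})` (`n_↑(1 - n_↓)` is a projection). [folklore] -/
theorem re_expect_nAt_mul_nAt_le (ω : InfVolFermionState 2) :
    (ω.expect {0} (nAt 0 (mem_singleton_self 0) 0 * nAt 0 (mem_singleton_self 0) 1)).re ≤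
      (ω.expect {0} (nAt (0 : Site 2) (mem_singleton_self 0) 0)).re := by
  have hc : Commute (nAt (0 : Site 2) (mem_singleton_self (0 : Site 2)) 0 : FermionOp {0})
      (1 - nAt 0 (mem_singleton_self 0) 1) :=
    (Commute.one_right _).sub_right (by rw [nAt, nAt, ← numberAt_orb, ← numberAt_orb]; exact numberAt_commute _ _)
  have hP := isHermitian_isIdempotentElem_mul_of_commute hc
    (by rw [nAt, ← numberAt_orb]; exact numberAt_isHermitian _)
    (by rw [nAt, ← numberAt_orb]; exact numberAt_idempotent _)
    (Matrix.isHermitian_one.sub (by rw [nAt, ← numberAt_orb]; exact numberAt_isHermitian _))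
    (by rw [nAt, ← numberAt_orb]; exact (numberAt_idempotent _).one_sub)
  have h := ω.re_expect_nonneg_of_isHermitian_of_isIdempotentElem {0} hP.1 hP.2
  rw [mul_sub, mul_one, map_sub, Complex.sub_re] at h
  linarith

/-- `Re ω(n_{0↑}) + Re ω(n_{0↓}) - 1 ≤ Re ω(n_{0↑} n_{0↓})` (`(1 - n_↑)(1 - n_↓)` is a
projection). [folklore] -/
theorem re_expect_nAt_add_sub_one_le (ω : InfVolFermionState 2) :
    (ω.expect {0} (nAt (0 : Site 2) (mem_singleton_self 0) 0)).re +
        (ω.expect {0} (nAt (0 : Site 2) (mem_singleton_self 0) 1)).re - 1 ≤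
      (ω.expect {0} (nAt 0 (mem_singleton_self 0) 0 * nAt 0 (mem_singleton_self 0) 1)).re := by
  have hc : Commute (1 - nAt (0 : Site 2) (mem_singleton_self (0 : Site 2)) 0 : FermionOp {0})
      (1 - nAt 0 (mem_singleton_self 0) 1) :=
    (Commute.one_left _).sub_left ((Commute.one_right _).sub_right
      (by rw [nAt, nAt, ← numberAt_orb, ← numberAt_orb]; exact numberAt_commute _ _))
  have hP := isHermitian_isIdempotentElem_mul_of_commute hc
    (Matrix.isHermitian_one.sub (by rw [nAt, ← numberAt_orb]; exact numberAt_isHermitian _))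
    (by rw [nAt, ← numberAt_orb]; exact (numberAt_idempotent _).one_sub)
    (Matrix.isHermitian_one.sub (by rw [nAt, ← numberAt_orb]; exact numberAt_isHermitian _))
    (by rw [nAt, ← numberAt_orb]; exact (numberAt_idempotent _).one_sub)
  have h := ω.re_expect_nonneg_of_isHermitian_of_isIdempotentElem {0} hP.1 hP.2
  rw [sub_mul, one_mul, mul_sub, mul_one, map_sub, map_sub, map_sub, ω.expect_one,
    Complex.sub_re, Complex.sub_re, Complex.sub_re, Complex.one_re] at h
  linarith

/-- The Hubbard energy density of a translation-invariant state, term by term: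
`e(ω) = U Re ω(n_{0↑}n_{0↓}) - t Σ_i Σ_σ Re (ω(c†_{0σ} c_{e_i σ}) + ω(c†_{e_i σ} c_{0σ}))`.
[cite: BratteliRobinsonII1997, §6.2.4] -/
theorem IsTranslationInvariant.hubbardEnergyDensity_eq_terms (hω : ω.IsTranslationInvariant) (t U : ℝ) :
    ω.hubbardEnergyDensity t U =
      U * (ω.expect {0} (nAt 0 (mem_singleton_self 0) 0 * nAt 0 (mem_singleton_self 0) 1)).re +
        ∑ i : Fin 2, -t * ∑ σ : Fin 2,
          ((ω.expect {0, 0 + unitVec i}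
              ((cAt 0 (mem_insert_self _ _) σ)ᴴ * cAt (0 + unitVec i) (mem_insert_of_mem (mem_singleton_self _)) σ)).re +
            (ω.expect {0, 0 + unitVec i}
              ((cAt (0 + unitVec i) (mem_insert_of_mem (mem_singleton_self _)) σ)ᴴ * cAt 0 (mem_insert_self _ _) σ)).re) := by
  rw [hubbardEnergyDensity, meanEnergy, hω.expect_hubbard_meanEnergyObs t U, Complex.add_re, Complex.re_sum,
    hubbardFermionInteraction_apply_singleton, map_smul, smul_eq_mul, Complex.re_ofReal_mul]
  congr 1
  refine Finset.sum_congr rfl fun i _ => ?_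
  rw [hubbardFermionInteraction_apply_pair, map_smul, map_sum, smul_eq_mul, ← Complex.ofReal_neg,
    Complex.re_ofReal_mul, Complex.re_sum]
  simp only [map_add, Complex.add_re]

/-- Occupation numbers in the bond region `{0, e_i}`: `ω_{\{0,e_i\}}(n_{0σ}) = ω_{\{0\}}(n_{0σ})`.
[folklore] -/
theorem expect_pair_nAt_zero (ω : InfVolFermionState 2) (i σ : Fin 2) :
    ω.expect {0, 0 + unitVec i} (nAt 0 (mem_insert_self _ _) σ) = ω.expect {0} (nAt 0 (mem_singleton_self 0) σ) := by
  rw [← ω.compatible (singleton_subset_iff.2 (mem_insert_self (0 : Site 2) {0 + unitVec i}))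
    (nAt 0 (mem_singleton_self 0) σ), nAt, fermionEmbed_numberOp, PolySite.incl_pt]

/-- `ω_{\{0,e_i\}}(n_{e_i σ}) = ω_{\{0\}}(n_{0σ})` for translation-invariant `ω`. [folklore] -/
theorem IsTranslationInvariant.expect_pair_nAt_unitVec (hω : ω.IsTranslationInvariant) (i σ : Fin 2) :
    ω.expect {0, 0 + unitVec i} (nAt (0 + unitVec i) (mem_insert_of_mem (mem_singleton_self _)) σ) =
      ω.expect {0} (nAt 0 (mem_singleton_self 0) σ) := by
  rw [← hω.expect_nAt (0 + unitVec i) σ, ← ω.compatible (singleton_subset_iff.2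
    (mem_insert_of_mem (mem_singleton_self (0 + unitVec i)) : 0 + unitVec i ∈ ({0, 0 + unitVec i} : Finset (Site 2))))
    (nAt (0 + unitVec i) (mem_singleton_self _) σ), nAt, fermionEmbed_numberOp, PolySite.incl_pt]

/-- **No hopping at density `0`**: `ω(c†_{0σ} c_{e_iσ}) = ω(c†_{e_iσ} c_{0σ}) = 0` when `ρ(ω) = 0`
(Cauchy–Schwarz with `ω(n) = 0`). [cite: BratteliRobinsonI1987, Lemma 2.3.10] -/
theorem IsTranslationInvariant.expect_hop_eq_zero_of_density_eq_zero (hω : ω.IsTranslationInvariant)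
    (hρ : ω.density = 0) (i σ : Fin 2) :
    ω.expect {0, 0 + unitVec i}
        ((cAt 0 (mem_insert_self _ _) σ)ᴴ * cAt (0 + unitVec i) (mem_insert_of_mem (mem_singleton_self _)) σ) = 0 ∧
      ω.expect {0, 0 + unitVec i}
        ((cAt (0 + unitVec i) (mem_insert_of_mem (mem_singleton_self _)) σ)ᴴ * cAt 0 (mem_insert_self _ _) σ) = 0 := by
  have h0 : ω.expect {0, 0 + unitVec i} ((cAt 0 (mem_insert_self _ _) σ)ᴴ * cAt 0 (mem_insert_self _ _) σ) = 0 := by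
    rw [show (cAt (0 : Site 2) (mem_insert_self _ _) σ)ᴴ * cAt 0 (mem_insert_self _ _) σ =
      (nAt 0 (mem_insert_self (0 : Site 2) {0 + unitVec i}) σ : FermionOp {0, 0 + unitVec i}) from rfl,
      expect_pair_nAt_zero, expect_nAt_eq_zero_of_density_eq_zero hρ]
  have he : ω.expect {0, 0 + unitVec i} ((cAt (0 + unitVec i) (mem_insert_of_mem (mem_singleton_self _)) σ)ᴴ *
      cAt (0 + unitVec i) (mem_insert_of_mem (mem_singleton_self _)) σ) = 0 := by
    rw [show (cAt (0 + unitVec i) (mem_insert_of_mem (mem_singleton_self _)) σ)ᴴ *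
        cAt (0 + unitVec i) (mem_insert_of_mem (mem_singleton_self _)) σ =
      (nAt (0 + unitVec i) (mem_insert_of_mem (mem_singleton_self (0 + unitVec i))) σ : FermionOp {0, 0 + unitVec i})
      from rfl, hω.expect_pair_nAt_unitVec, expect_nAt_eq_zero_of_density_eq_zero hρ]
  exact ⟨ω.expect_conjTranspose_mul_eq_zero _ _ h0, ω.expect_conjTranspose_mul_eq_zero _ _ he⟩

/-- **No hopping at density `2`**: `ω(c†_{0σ} c_{e_iσ}) = ω(c†_{e_iσ} c_{0σ}) = 0` when `ρ(ω) = 2`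
(Cauchy–Schwarz for the holes, `ω(c c†) = 1 - ω(n) = 0`). [cite: BratteliRobinsonI1987, Lemma 2.3.10] -/
theorem IsTranslationInvariant.expect_hop_eq_zero_of_density_eq_two (hω : ω.IsTranslationInvariant)
    (hρ : ω.density = 2) (i σ : Fin 2) :
    ω.expect {0, 0 + unitVec i}
        ((cAt 0 (mem_insert_self _ _) σ)ᴴ * cAt (0 + unitVec i) (mem_insert_of_mem (mem_singleton_self _)) σ) = 0 ∧
      ω.expect {0, 0 + unitVec i}
        ((cAt (0 + unitVec i) (mem_insert_of_mem (mem_singleton_self _)) σ)ᴴ * cAt 0 (mem_insert_self _ _) σ) = 0 := by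
  -- the two orbitals
  have hne : orb (PolySite.pt (0 + unitVec i) (mem_insert_of_mem (mem_singleton_self (0 + unitVec i)))) σ ≠
      (orb (PolySite.pt (0 : Site 2) (mem_insert_self (0 : Site 2) {0 + unitVec i})) σ : Orb (PolySite {0, 0 + unitVec i})) := by
    intro h
    have h1 : (0 : Site 2) + unitVec i = 0 :=
      congrArg (fun o : Orb (PolySite ({0, 0 + unitVec i} : Finset (Site 2))) => ofLex ((ofLex o).1).1) h
    exact self_ne_add_unitVec (0 : Site 2) i h1.symm
  have hCAR := annihilation_mul_creation_add_creation_mul_annihilation_holds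
    (ι := Orb (PolySite ({0, 0 + unitVec i} : Finset (Site 2))))
  -- full orbitals: `ω(c c†) = 0` at both ends of the bond
  have hfull : ∀ (x : Site 2) (hx : x ∈ ({0, 0 + unitVec i} : Finset (Site 2))),
      ω.expect {0, 0 + unitVec i} (nAt x hx σ) = 1 →
        ω.expect {0, 0 + unitVec i} ((creation (orb (PolySite.pt x hx) σ))ᴴ * creation (orb (PolySite.pt x hx) σ)) = 0 := by
    intro x hx h1
    have h := hCAR (orb (PolySite.pt x hx) σ) (orb (PolySite.pt x hx) σ)
    rw [if_pos rfl] at h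
    rw [creation_conjTranspose, eq_sub_of_add_eq h, map_sub, ω.expect_one]
    rw [nAt, numberOp] at h1
    rw [h1, sub_self]
  have h0 : ω.expect {0, 0 + unitVec i} (nAt 0 (mem_insert_self _ _) σ) = 1 := by
    rw [expect_pair_nAt_zero, expect_nAt_eq_one_of_density_eq_two hρ]
  have he : ω.expect {0, 0 + unitVec i} (nAt (0 + unitVec i) (mem_insert_of_mem (mem_singleton_self _)) σ) = 1 := by
    rw [hω.expect_pair_nAt_unitVec, expect_nAt_eq_one_of_density_eq_two hρ]
  -- anticommute and apply Cauchy–Schwarz to the holes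
  have hswap : ∀ {a b : Orb (PolySite ({0, 0 + unitVec i} : Finset (Site 2)))}, a ≠ b →
      (annihilation a)ᴴ * annihilation b = -((creation b)ᴴ * creation a) := by
    intro a b hab
    have h := hCAR b a
    rw [if_neg hab.symm] at h
    rw [annihilation_conjTranspose, creation_conjTranspose]
    exact eq_neg_of_add_eq_zero_right h
  constructor
  · rw [cAt, cAt, hswap hne.symm, map_neg, ω.expect_conjTranspose_mul_eq_zero _ _ (hfull _ _ he), neg_zero]
  · rw [cAt, cAt, hswap hne, map_neg, ω.expect_conjTranspose_mul_eq_zero _ _ (hfull _ _ h0), neg_zero]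

/-- **The translation-invariant states of density `0` have energy density `0`** (no particles: no
hopping by Cauchy–Schwarz, no double occupancy). [cite: BratteliRobinsonII1997, §6.2.4] -/
theorem IsTranslationInvariant.hubbardEnergyDensity_eq_zero_of_density_eq_zero (hω : ω.IsTranslationInvariant)
    (t U : ℝ) (hρ : ω.density = 0) : ω.hubbardEnergyDensity t U = 0 := by
  have hnn : (ω.expect {0} (nAt 0 (mem_singleton_self 0) 0 * nAt 0 (mem_singleton_self 0) 1)).re = 0 := by
    have h1 := ω.re_expect_nAt_mul_nAt_le
    have h2 := ω.re_expect_nAt_add_sub_one_le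
    have hP := isHermitian_isIdempotentElem_mul_of_commute (P := (nAt (0 : Site 2) (mem_singleton_self 0) 0 : FermionOp {0}))
      (Q := nAt 0 (mem_singleton_self 0) 1)
      (by rw [nAt, nAt, ← numberAt_orb, ← numberAt_orb]; exact numberAt_commute _ _)
      (by rw [nAt, ← numberAt_orb]; exact numberAt_isHermitian _)
      (by rw [nAt, ← numberAt_orb]; exact numberAt_idempotent _)
      (by rw [nAt, ← numberAt_orb]; exact numberAt_isHermitian _)
      (by rw [nAt, ← numberAt_orb]; exact numberAt_idempotent _)
    have h3 := ω.re_expect_nonneg_of_isHermitian_of_isIdempotentElem {0} hP.1 hP.2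
    have h4 : (ω.expect {0} (nAt (0 : Site 2) (mem_singleton_self 0) 0)).re = 0 := by
      rw [expect_nAt_eq_zero_of_density_eq_zero hρ, Complex.zero_re]
    linarith
  rw [hω.hubbardEnergyDensity_eq_terms, hnn, mul_zero, zero_add]
  refine Finset.sum_eq_zero fun i _ => ?_
  rw [Finset.sum_eq_zero fun σ _ => ?_, mul_zero]
  rw [(hω.expect_hop_eq_zero_of_density_eq_zero hρ i σ).1, (hω.expect_hop_eq_zero_of_density_eq_zero hρ i σ).2,
    Complex.zero_re, add_zero]

/-- **The translation-invariant states of density `2` have energy density `U`** (every orbital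
full: no hopping by Cauchy–Schwarz for the holes, double occupancy `1`).
[cite: BratteliRobinsonII1997, §6.2.4] -/
theorem IsTranslationInvariant.hubbardEnergyDensity_eq_of_density_eq_two (hω : ω.IsTranslationInvariant)
    (t U : ℝ) (hρ : ω.density = 2) : ω.hubbardEnergyDensity t U = U := by
  have hnn : (ω.expect {0} (nAt 0 (mem_singleton_self 0) 0 * nAt 0 (mem_singleton_self 0) 1)).re = 1 := by
    have h1 := ω.re_expect_nAt_mul_nAt_le
    have h2 := ω.re_expect_nAt_add_sub_one_le
    have h4 : ∀ σ : Fin 2, (ω.expect {0} (nAt (0 : Site 2) (mem_singleton_self 0) σ)).re = 1 := fun σ => by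
      rw [expect_nAt_eq_one_of_density_eq_two hρ, Complex.one_re]
    have h40 := h4 0
    have h41 := h4 1
    linarith
  rw [hω.hubbardEnergyDensity_eq_terms, hnn, mul_one, add_eq_left]
  refine Finset.sum_eq_zero fun i _ => ?_
  rw [Finset.sum_eq_zero fun σ _ => ?_, mul_zero]
  rw [(hω.expect_hop_eq_zero_of_density_eq_two hρ i σ).1, (hω.expect_hop_eq_zero_of_density_eq_two hρ i σ).2,
    Complex.zero_re, add_zero]

end Extreme

/-! ### The chemical potential of a canonical minimiser -/

/-- `e(0) ≤ 0`: the empty sector has energy `0` on every torus. [cite: Ruelle1969, §3.3] -/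
theorem _root_.Literature.MathematicalPhysics.QuantumLattice.ThermodynamicLimit.energyDensity2D_zero_le
    (t : ℝ) {U : ℝ} (hU : 0 ≤ U) : energyDensity2D t U 0 ≤ 0 := by
  have h : ∀ ℓ : ℕ, 1 ≤ ℓ → energyDensity2D t U 0 ≤ 16 * |t| / ℓ := by
    intro ℓ hℓ
    have h1 := energyDensity2D_le_of_lt t hU hℓ (N := 0) (by positivity)
    rwa [Nat.cast_zero, zero_div, groundEnergyAt_zero_eq, zero_div, zero_add] at h1
  refine le_of_forall_pos_lt_add fun ε hε => ?_
  obtain ⟨ℓ, hℓ⟩ := exists_nat_gt (16 * |t| / ε)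
  have hℓpos : (0 : ℝ) < (ℓ : ℝ) + 1 := by positivity
  have h1 := h (ℓ + 1) (Nat.le_add_left 1 ℓ)
  push_cast at h1
  have h2 : 16 * |t| / ((ℓ : ℝ) + 1) < ε := by
    rw [div_lt_iff₀ hℓpos]
    rw [div_lt_iff₀ hε] at hℓ
    nlinarith [abs_nonneg t]
  linarith

/-- **The chemical potential of a canonical minimiser.** For `U ≥ 0`: if a translation-invariant
state `ω` on `ℤ²` of density `ρ(ω) ∈ (0,2)` attains Ruelle's energy density,
`e(ω) = energyDensity2D t U ρ(ω)` (e.g. every torus limit of sector ground states,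
`IsTorusLimitOf.hubbardEnergyDensity_eq_energyDensity2D`), then there is a chemical potential `μ`
(any supporting slope of the convex `energyDensity2D t U` at `ρ(ω)`) such that `ω` minimises the
grand-canonical mean energy `e(ω') - μ ρ(ω')` among ALL translation-invariant states `ω'`:
interior densities by the variational bound `energyDensity2D_le_hubbardEnergyDensity` and the
supporting line, the extreme densities `0` and `2` by `e(ω') = 0`, resp. `e(ω') = U ≥ e(ρ) + μ(2 - ρ)`.
Ruelle (1969) §3.4 (equivalence of the canonical and grand-canonical descriptions);
Bratteli–Robinson II §6.2.4. [cite: Ruelle1969, §3.4] -/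
theorem exists_chemicalPotential_of_hubbardEnergyDensity_eq {ω : InfVolFermionState 2}
    (t : ℝ) {U : ℝ} (hU : 0 ≤ U) (hρ0 : 0 < ω.density) (hρ2 : ω.density < 2)
    (hmin : ω.hubbardEnergyDensity t U = energyDensity2D t U ω.density) :
    ∃ μ : ℝ, ∀ ω' : InfVolFermionState 2, ω'.IsTranslationInvariant →
      ω.hubbardEnergyDensity t U - μ * ω.density ≤ ω'.hubbardEnergyDensity t U - μ * ω'.density := by
  obtain ⟨s, hs⟩ := exists_supporting_line_energyDensity2D t hU hρ0 hρ2
  refine ⟨s, fun ω' hω' => ?_⟩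
  rw [hmin]
  rcases (ω'.density_nonneg).eq_or_lt with h0 | h0
  · -- density 0
    rw [← h0, hω'.hubbardEnergyDensity_eq_zero_of_density_eq_zero t U h0.symm, mul_zero, sub_zero]
    have h1 := hs 0 ⟨le_rfl, two_pos⟩
    have h2 := energyDensity2D_zero_le t hU
    linarith
  rcases (ω'.density_le_two).eq_or_lt with h2 | h2
  · -- density 2
    rw [h2, hω'.hubbardEnergyDensity_eq_of_density_eq_two t U h2]
    have h1 := supporting_line_at_two_le t hU hs
    linarith
  · -- density in (0,2)
    have h1 := hs ω'.density ⟨h0.le, h2⟩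
    have h3 := hω'.energyDensity2D_le_hubbardEnergyDensity t hU h0 h2
    linarith

end InfVolFermionState

end Literature.MathematicalPhysics.QuantumLattice

end
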